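import Mathlib
import HarnessLib
import Summits.NavierStokesRegularity.NavierStokesRegularity.Theses.QuarterLogPincer
import Summits.NavierStokesRegularity.NavierStokesRegularity.Theorems.QuarterLogPincerThinCascadeDefs
import Summits.NavierStokesRegularity.NavierStokesRegularity.Theorems.QuarterLogPincerTypeIQuantSubcubicExpLiouvilleTransfer
import Summits.NavierStokesRegularity.NavierStokesRegularity.Theorems.QuarterLogPincerTypeIQuantSubcubicExpLiouvilleEdges
import Literature.Analysis.FluidPDE.SelfSimilar
import Literature.Analysis.FluidPDE.SelfSimilarWeakLp
import Literature.Analysis.FluidPDE.TypeIAncientMild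
import Literature.Analysis.FluidPDE.TypeIAncientMildDecay
import Literature.Analysis.FluidPDE.ChaeWolfRemovingDSS
import Literature.Analysis.FluidPDE.ChaeWolfRemovingDSSHolds
import Literature.Analysis.FluidPDE.BarkerPrange2021QuantitativeRates
import Literature.Analysis.FluidPDE.ChaeWolfRemovingDSSLimit
import Literature.Analysis.FluidPDE.SteadyLiouvilleTsaiPressure
import Literature.Analysis.FunctionSpaces.WeakLp

/-!
# Line `trace-floor` for crux `QuarterLogPincer.TypeIQuantSubcubicExp` (stmt-NavierStokesRegularity-24077)

ns-idea-7 g7 (lens «nearmiss», target «DSS wall»); v2 (E split into E2 + E3, E derived).  No summit is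
proved by this line.  RUNG LINE on the
ALL-`λ` side of the DSS wall (away from the exhausted near-one cone), honest width 0 on the wall itself.

## The near-miss of record and its measured deficit

Barker–Prange 2021, Cor. 1 (tree NAMED FACT `Literature.Analysis.FluidPDE.barkerPrange2021_dss_log_rate`;
Thm 1 = `barkerPrange2021_typeI_log_rate`; arXiv:2003.06717 pp. 3–4): a non-zero backward `λ`-DSS
solution (any `λ > 1`) deposits
`log(1/(−t)^{δ/2}) / exp(exp(M^1025)) ≤ ∫_{B(1)} |u(x,t)|³ dx ≤ M³ log(2/√(−t))`:
per e-fold of `log(1/(−t))` the local cube grows by at least `q_BP(M) = (δ/2)·exp(−exp(M^1025))` and at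
most `M³`.  In the language of the registered line `thin_cascade` (S3 `stub_thinCascadeLiouville`: «no
THIN singular Type-I ancient object `ThinObject M q v g`», the wall), every DSS thin object has trace
budget slope `q ≥ q_BP(M) > 0` — a DOUBLE-EXPONENTIALLY thin sliver of the wall is closed for every `λ`.

MEASURED DEFICIT = the second exponential.  Anatomy (arXiv:2003.06717 §2, pp. 10–11, 16–17): Thm 1 ⇐
Prop. 2, whose price `exp(exp(M^1024))` per unit of `L³` mass has exactly ONE super-polynomial source —
Cor. 12's PIGEONHOLED annulus of quantitative regularity `R₂' ∈ [2R₂, 2R₂·exp(C(100)M^1020)]`,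
`R₂ = K♯√T₂` (p. 16), fed into Gaussian Carleman weights costing `exp(O(M^2000)(R₂')²/T₂)` (Steps 2–3:
every cost is `exp(O(R₃²/T₂))` with `R₃ ≤ poly(M)·R₂'`) and forcing the epoch spacing `exp(M^1023)`;
the Type-I epochs of regularity themselves cost `poly(M)`.

## The single input to improve (the lever)

In the ENVELOPE class `|v(x,t)| ≤ C/(|x| + √(−t))` — which contains EVERY `λ`-DSS solution of the
Chae–Wolf class (Chae–Wolf 2017 Thm 1.1 = tree THEOREM `chaeWolf2017_dss_typeI_decay_holds`), with the
scale-invariant derivative envelope `(|x|+√(−t))^{n+1}|Dⁿv| ≤ K(n,C)` a tree THEOREM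
(`IsTypeIAncientMild.exists_forall_pow_mul_norm_iteratedFDeriv_le_of_hasTypeIDecay`) — the annulus
`{|x| ≥ poly(C)·√T₂}` is a region of quantitative regularity FOR FREE at every time up to the singular
time: no pigeonhole, `R₂'/√T₂ = poly(C)`, every Carleman cost `exp(poly(C))`, epoch spacing `poly(C)`.
Conjecture (stub E2 below; trace form E derived): the floor improves to ONE exponential, `q ≥ exp(−C^κ)`.  This is the move
«a free region of regularity removes one exponential» (Palasek 2021, arXiv:2101.08586 §3.4 / Prop. 8,
classes `‖r^{1−3/q}u‖_{L^∞L^q} ≤ A`, `q < ∞`, Tao's framework; Barker 2025, arXiv:2510.20757 §1.2.1 /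
Prop. 11, approximately axisymmetric data) transplanted to Barker–Prange's Type-I scheme, where the
additive quantity is the LOCAL `L³` budget — so Palasek's caveat that `L^∞`-type classes are out of reach
of UPPER bounds (p. 4) does not apply to this LOWER bound.  The envelope also puts the field in
Barker–Prange's Type-I class with `M = (4π/3)^{1/3}·C` (PROVED below, `eWeakLpPow_three_le_of_hasTypeIDecay`).

## Items (v5: E2 = E2a + E2b; E = E2 + E3; E3 = E3a′ + DSS rescaling + E3b; E, E3a, E3b DERIVED / PROVED)

* E2a `stub_polyDerivEnvelope` — SUPPORT-grade, provable now, M-sized: `PolyDerivEnvelope` (the tree's class-uniform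
  derivative envelope `∃ K(n,C)`, n ≤ 3, made polynomial `A·C^m`; scaled local regularity) — E2's first internal step.
* E2b `stub_ballFloorSingleExp_of_polyEnvelope` — RUNG, conjectural, L-sized, THE CONTENT: `PolyDerivEnvelope → ∃ κ, BallFloorSingleExp κ`:
  every non-zero `c`-DSS Type-I ancient mild solution with envelope constant `C ≥ 2` has the BALL-FORM floor
  `exp(−C^κ)·log(1/(−t)) ≤ ∫_{B(1)}|v(t)|³` on a window `[t₀,0)` — Barker–Prange Cor. 1's literal shape with
  `θ = exp(−C^κ)` in place of `(δ/2)exp(−exp(M^1025))`.  R0 (known, double-exponential): BP21 Cor. 1 — its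
  per-solution `∃ θ > 0` unpacking is PROVED below from the named fact (`ballFloor_pos_of_BP21`).
* E3a′ `stub_sliceShellBudget` — SUPPORT-grade, unconditional, M/L-sized, the ANALYTIC statement (NO self-similarity):
  for ANY enveloped thin object with `q > 0`, `∫_{B(R)}|v(−1)|³ ≤ b + 2q(1 + log R)` for all `R ≥ 1` (the slice
  at `t = −1` inherits the trace budget up to a factor 2: `|v(−1,y) − g(y)| ≤ ∫_{−1}^{0}|∂_t v| ≲ C·K·log(2+|y|)/|y|³`
  from the derivative envelope and the Oseen pressure; Minkowski/Young; the thin budget).  Provable now; no wall.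
* E3a `sliceBudget_of_shell` — PROVED here: `SliceShellBudget → SliceBudget` by the DSS rescaling identity
  `∫_{B(1)}|v(−c^{−2k})|³ = ∫_{B(c^k)}|v(−1)|³` (`lintegral_ball_dss_time`, PROVED: pointwise
  `v(t_k,x) = c^k v(−1,c^k x)` + change of variables).
* E3b `sliceToTrace_of_sliceBudget` — PROVED here: `SliceBudget → SliceToTrace` (a ball floor of slope
  `θ > 0` then forces `θ ≤ q`: `2kθ log c ≤ b + 2q + 2qk log c` for all large `k` is impossible if `q < θ`).
* E  `envelopeTraceFloor_of` — THEOREM: `E2 → SliceToTrace → ∃ κ, ThinEnvelopeFloor κ` (every `c`-DSS thin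
  object with `q > 0` and envelope constant `C ≥ 2` has `q ≥ exp(−C^κ)`), kernel-checked here.
* W  `stub_residualWall` — the WALL minus E's sliver, at E's level: `∀ κ, ThinEnvelopeFloor κ → (no thin
  object with q > 0 outside the kill zone of level κ)`.  Honest width 0: contains every non-DSS thin object.
* `TypeIQuantSubcubicExp_of : E2a → E2b → E3a′ → W → crux` BY NAME (E3a, E3b, E derived; case split on the kill zone;
  per-`M` edge `quantSubcubicExpAt_of_noThinObject`, tree).

BC9 / method ceiling.  Family = quantitative Carleman (backward uniqueness + unique continuation) under
Type I.  Ladder of trace floors: `0` (ESS 2003 / Albritton–Barker 2019, tree) < double-exp (BP21, tree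
fact) < single-exp (E) < … < `∞` (= S3, the wall).  CEILING of the family = ONE exponential («due to the
stacking of scales, we always get at least one exponential», Barker–Prange survey arXiv:2211.16215 p. 12
fn.; the Carleman inequality across an annulus of ratio `poly(M)` costs `exp(O(M^2000)(r₊/√S)²)`, BP21
p. 16).  So E is the LAST rung this family can reach; W lies beyond it (declared).

Instrument row.  A numerical backward-DSS profile (any `λ`) with envelope constant `C` and per-period
trace budget `Q₁ = ∫_{1<|x|<λ}|g|³ < exp(−C^κ)·log λ` refutes E at level `κ`; BP21 already forbids
`Q₁ < q_BP·log λ`.  Searches: CENSUS-Z2 / pub-ns-dss report `(λ, C, Q₁/log λ)`.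

References: [BarkerPrange2021] arXiv:2003.06717 Thm 1, Cor 1, Prop 2, Cor 12, §2 pp. 10–11, 16–17;
[Palasek2021] arXiv:2101.08586 pp. 2–4, §3.4 Prop 8 (p. 62 of the held text); [Barker2025]
arXiv:2510.20757 §1.2.1 p. 5, Prop 11; [BarkerPrange2023survey] arXiv:2211.16215 §7 p. 14, p. 12 fn.;
[ChaeWolf2017RemovingDSS] arXiv:1610.09464 Thm 1.1, (3.6); [AlbrittonBarker2019] Thm 4.1;
[EscauriazaSereginSverak2003].
-/

noncomputable section

set_option linter.dupNamespace false

namespace Summit.NavierStokesRegularity.NavierStokesRegularity.Cruxes.TypeIQuantSubcubicExp.TraceFloor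

open MeasureTheory Set Function Metric Filter Topology
open scoped ENNReal NNReal
open Literature.Analysis Literature.Analysis.FluidPDE
open Summit.NavierStokesRegularity.NavierStokesRegularity.Cruxes.TypeIQuantSubcubicExp.ThinCascade
open Summit.NavierStokesRegularity.NavierStokesRegularity.Theorems.ThinCascade


/-! ### Definitions of the line -/

/-- The KILL ZONE of level `κ`: a thin object `(q, v)` is killed by the envelope trace floor of level
`κ` if `v` is `c`-discretely self-similar for some `c > 1`, carries a Type-I space–time envelope
`|v| ≤ C/(|x|+√(−t))` with `C ≥ 2`, and its budget slope is below the floor: `q < exp(−C^κ)`. [this file; line object] -/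
def KilledByFloor (κ : ℕ) (q : ℝ) (v : ℝ → EuclideanSpace ℝ (Fin 3) → EuclideanSpace ℝ (Fin 3)) : Prop :=
  ∃ C c : ℝ, 1 < c ∧ IsDiscretelySelfSimilar c v ∧ HasTypeIDecay C v ∧ 2 ≤ C ∧
    q < Real.exp (-(C ^ κ))

/-- The ENVELOPE TRACE FLOOR of level `κ` (conjectural for every `κ`; Barker–Prange 2021 Cor. 1 gives
the double-exponential analogue `q ≥ (δ/2)exp(−exp(M^1025))`): no thin object lies in the kill zone of
level `κ`, i.e. every `c`-DSS thin object `ThinObject M q v g` with envelope constant `C ≥ 2` has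
`q ≥ exp(−C^κ)`. [this file; line object] -/
def ThinEnvelopeFloor (κ : ℕ) : Prop :=
  ∀ (M q : ℝ) (v : ℝ → EuclideanSpace ℝ (Fin 3) → EuclideanSpace ℝ (Fin 3)) (g : EuclideanSpace ℝ (Fin 3) → EuclideanSpace ℝ (Fin 3)), 0 < q → ThinObject M q v g → ¬ KilledByFloor κ q v

/-- The RESIDUAL WALL of level `κ`: no thin object with positive budget outside the kill zone of level
`κ`.  (Width 0: every thin object that is not DSS, or DSS without a recorded envelope, or DSS with
`q ≥ exp(−C^κ)`, is in the residual.) [this file; line object] -/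
def ResidualWall (κ : ℕ) : Prop :=
  ∀ (M q : ℝ) (v : ℝ → EuclideanSpace ℝ (Fin 3) → EuclideanSpace ℝ (Fin 3)) (g : EuclideanSpace ℝ (Fin 3) → EuclideanSpace ℝ (Fin 3)), 0 < q → ¬ KilledByFloor κ q v → ¬ ThinObject M q v g

/-- **Polynomial derivative envelope** (E2a; Chae–Wolf 2017 (3.6) / the tree's class-uniform
`IsTypeIAncientMild.exists_forall_pow_mul_norm_iteratedFDeriv_le_of_hasTypeIDecay`, made EXPLICIT in `C`):
there are absolute `A`, `m` such that every Type-I ancient mild solution `IsTypeIAncientMild C V` with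
space–time envelope `HasTypeIDecay C V`, `C ≥ 2`, obeys the scale-invariant gauge bounds
`(‖x‖ + √(−t))^{n+1} ‖DⁿV(t,·)(x)‖ ≤ A·C^m` for `n ≤ 3`, all `t < 0`, `x`.  Mechanism: scaled local
regularity on backward cylinders of radius `r/(2C)`, `r = ‖x‖ + √(−t)` (local Reynolds number made `O(1)`
by shrinking the cylinder, each bootstrap step polynomial; heuristically `m = n + 1`).  This is the first
internal step of E2: Barker–Prange's scheme needs the derivative inputs at worst `exp(poly C)`.
[this file; line object] -/
def PolyDerivEnvelope : Prop :=
  ∃ A : ℝ, ∃ m : ℕ, ∀ (C : ℝ) (V : ℝ → EuclideanSpace ℝ (Fin 3) → EuclideanSpace ℝ (Fin 3)),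
    2 ≤ C → IsTypeIAncientMild C V → HasTypeIDecay C V →
    ∀ n : ℕ, n ≤ 3 → ∀ t : ℝ, t < 0 → ∀ x : EuclideanSpace ℝ (Fin 3),
      (‖x‖ + Real.sqrt (-t)) ^ (n + 1) * ‖iteratedFDeriv ℝ n (V t) x‖ ≤ A * C ^ m

/-- **Ball-form single-exponential floor of level `κ`** (Barker–Prange 2021 Cor. 1's literal shape,
arXiv:2003.06717 pp. 3–4, with `θ = exp(−C^κ)`): every NON-ZERO `c`-discretely-self-similar Type-I ancient
mild solution (`IsTypeIAncientMild C v`, unit viscosity) with space–time envelope `‖v(t,x)‖ ≤ C/(‖x‖+√(−t))`,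
`C ≥ 2`, satisfies `exp(−C^κ)·log(1/(−t)) ≤ ∫_{B(0,1)} ‖v(t,x)‖³ dx` for all `t` in some window `[t₀, 0)`. [this file; line object] -/
def BallFloorSingleExp (κ : ℕ) : Prop :=
  ∀ (C c : ℝ) (v : ℝ → EuclideanSpace ℝ (Fin 3) → EuclideanSpace ℝ (Fin 3)), 2 ≤ C → 1 < c →
    IsDiscretelySelfSimilar c v → IsTypeIAncientMild C v → HasTypeIDecay C v →
    (∃ t : ℝ, t < 0 ∧ ∃ x, v t x ≠ 0) →
    ∃ t₀ : ℝ, t₀ < 0 ∧ ∀ t ∈ Set.Ico t₀ 0,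
      ENNReal.ofReal (Real.exp (-(C ^ κ)) * Real.log (1 / (-t))) ≤
        ∫⁻ x in Metric.ball (0 : EuclideanSpace ℝ (Fin 3)) 1, ‖v t x‖ₑ ^ (3 : ℕ)

/-- **Slice-to-trace transfer** (constant-free): for a `c`-DSS thin object `ThinObject M q v g` with an
envelope `HasTypeIDecay C v`, any ball-form floor `θ·log(1/(−t)) ≤ ∫_{B(1)}‖v(t)‖³` on a window `[t₀,0)`
with `θ > 0` forces `θ ≤ q`.  Mechanism: at the DSS times `t_k = −c^{−2k}` the ball cube equals
`∫_{B(c^k)}‖v(−1)‖³ ≥ 2kθ log c`; off the unit ball the slice `v(−1,·)` differs from the trace `g` by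
`∫_{−1}^{0}|∂_t v| ≲ C·K·log(2+|y|)/|y|³` (derivative envelope + Oseen pressure: core part `≲ C²/|y|⁴`,
far part Calderón–Zygmund with a logarithm), whose cube is integrable on `{|y|>1}`; so the shell masses
of `g` grow at slope `≥ 2θ` per unit of `log R` while the budget allows `q(1 + log R)`: `q ≥ 2θ ≥ θ`. [this file; line object] -/
def SliceToTrace : Prop :=
  ∀ (M q C c θ : ℝ) (v : ℝ → EuclideanSpace ℝ (Fin 3) → EuclideanSpace ℝ (Fin 3))
    (g : EuclideanSpace ℝ (Fin 3) → EuclideanSpace ℝ (Fin 3)),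
    ThinObject M q v g → 0 < q → 0 ≤ C → HasTypeIDecay C v → 1 < c → IsDiscretelySelfSimilar c v →
    0 < θ →
    (∃ t₀ : ℝ, t₀ < 0 ∧ ∀ t ∈ Set.Ico t₀ 0,
      ENNReal.ofReal (θ * Real.log (1 / (-t))) ≤
        ∫⁻ x in Metric.ball (0 : EuclideanSpace ℝ (Fin 3)) 1, ‖v t x‖ₑ ^ (3 : ℕ)) →
    θ ≤ q

/-- **Slice budget at the DSS times** (E3a, the analytic half of the transfer): for a `c`-DSS thin
object `ThinObject M q v g` (`q > 0`) with an envelope `HasTypeIDecay C v`, the unit-ball cubes at the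
DSS times `t_k = −c^{−2k}` grow at most like twice the trace budget:
`∫_{B(1)}‖v(t_k)‖³ ≤ b + 2q(1 + k log c)` for some `b` and all `k`.  Mechanism: DSS rescaling gives
`∫_{B(1)}‖v(t_k)‖³ = ∫_{B(c^k)}‖v(−1)‖³ = ∫_{B(1)}‖v(−1)‖³ + ∫_{1<|y|<c^k}‖v(−1)‖³`; off the unit ball
the slice `v(−1,·)` differs from the trace `g` by `D(y) = ∫_{−1}^{0}|∂_t v| ≲ (CK₁log(2+|y|) + K₂ + C²)/|y|³`
(derivative envelope + Oseen pressure gradient: core part `≲ C²/|y|⁴` since `|v|² ≤ C²/|x|²` is uniformly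
`L¹` on `B(1/2)`, far part Calderón–Zygmund with a logarithm), `d := ‖D‖_{L³(|y|>1)} < ∞`; Minkowski and
Young give `∫_{1<|y|<R}‖v(−1)‖³ ≤ (G_R^{1/3} + d)³ ≤ 2G_R + 28d³` with `G_R = ∫_{1<|y|<R}‖g‖³ ≤ q(1 + log R)`
(the thin budget).  Unconditional; no constants enter except through `b`. [this file; line object] -/
def SliceBudget : Prop :=
  ∀ (M q C c : ℝ) (v : ℝ → EuclideanSpace ℝ (Fin 3) → EuclideanSpace ℝ (Fin 3))
    (g : EuclideanSpace ℝ (Fin 3) → EuclideanSpace ℝ (Fin 3)),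
    ThinObject M q v g → 0 < q → 0 ≤ C → HasTypeIDecay C v → 1 < c → IsDiscretelySelfSimilar c v →
    ∃ b : ℝ, ∀ k : ℕ,
      ∫⁻ x in Metric.ball (0 : EuclideanSpace ℝ (Fin 3)) 1, ‖v (-(c ^ (2 * k))⁻¹) x‖ₑ ^ (3 : ℕ) ≤
        ENNReal.ofReal (b + 2 * q * (1 + k * Real.log c))

/-- **Slice shell budget** (E3a′, the analytic statement; NO self-similarity hypothesis): for ANY thin
object `ThinObject M q v g` with `q > 0` and an envelope `HasTypeIDecay C v`, the slice at `t = −1`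
inherits the trace budget up to a factor 2: `∫_{B(R)}‖v(−1)‖³ ≤ b + 2q(1 + log R)` for all `R ≥ 1`.
Mechanism: on `{|y| > 1}` the slice `v(−1,·)` and the weak trace `g` (identified with the pointwise limit
off the origin) differ by `D(y) = ∫_{−1}^{0}|∂_t v(s,y)| ds ≲ (CK₁log(2+|y|) + K₂ + C²)/|y|³` (derivative
envelope + Oseen pressure gradient: core part `≲ C²/|y|⁴` since `|v|² ≤ C²/|x|²` is uniformly `L¹` on
`B(1/2)`, far part Calderón–Zygmund with a logarithm), `d := ‖D‖_{L³(|y|>1)} < ∞`; Minkowski and Young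
give `∫_{1<|y|<R}‖v(−1)‖³ ≤ (G_R^{1/3} + d)³ ≤ 2G_R + 28d³`, `G_R = ∫_{1<|y|<R}‖g‖³ ≤ q(1 + log R)` (thin
budget), and `∫_{B(1)}‖v(−1)‖³ ≤ (4π/3)C³`. [this file; line object] -/
def SliceShellBudget : Prop :=
  ∀ (M q C : ℝ) (v : ℝ → EuclideanSpace ℝ (Fin 3) → EuclideanSpace ℝ (Fin 3))
    (g : EuclideanSpace ℝ (Fin 3) → EuclideanSpace ℝ (Fin 3)),
    ThinObject M q v g → 0 < q → 0 ≤ C → HasTypeIDecay C v →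
    ∃ b : ℝ, ∀ R : ℝ, 1 ≤ R →
      ∫⁻ x in Metric.ball (0 : EuclideanSpace ℝ (Fin 3)) R, ‖v (-1) x‖ₑ ^ (3 : ℕ) ≤
        ENNReal.ofReal (b + 2 * q * (1 + Real.log R))

/-! ### Registered stubs -/

/-- **E2a (SUPPORT-grade, provable now; first internal step of E2).**  The class-uniform derivative
envelope of the tree (`IsTypeIAncientMild.exists_forall_pow_mul_norm_iteratedFDeriv_le_of_hasTypeIDecay`,
`∃ K(n,C)`) made POLYNOMIAL in `C` for `n ≤ 3`: see `PolyDerivEnvelope`.  Why true: scaled local regularity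
on backward cylinders of radius `r/(2C)` about `(t,x)`, `r = ‖x‖ + √(−t)`, where `|V| ≤ 2C/r` (the local
Reynolds number is `O(1)` after shrinking; smoothing time `≍ r²/C²`; each bootstrap step costs a polynomial;
the pressure's far part is harmonic with gradient `≲ C²/r³`).  Why it might fail (Lean cost): interior
regularity for Oseen-mild solutions with LOCAL `L^∞` control is not yet a tree lemma (the tree's proof of
the `∃ K` version goes through the classical representation).  Sources: arXiv:1610.09464 §3 (3.6);
Pineau–Vicol (7.2). -/
theorem stub_polyDerivEnvelope : PolyDerivEnvelope := by
  sorry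

/-- **E2b (RUNG, conjectural; the content of the line).**  SINGLE-EXPONENTIAL ball-form floor GIVEN the
polynomial derivative envelope E2a: there is a universal exponent `κ` such that every non-zero discretely self-similar Type-I ancient mild solution
with space–time envelope constant `C ≥ 2` obeys `exp(−C^κ)·log(1/(−t)) ≤ ∫_{B(1)}|v(t)|³` near the
singular time.  Why plausibly true: re-run Barker–Prange 2021 Prop. 2 (arXiv:2003.06717 §2 Steps 1–4)
with the FREE annulus of quantitative regularity `{|x| ≥ poly(C)√T₂}` supplied by the envelope and its
derivative bounds (tree: `IsTypeIAncientMild.exists_forall_pow_mul_norm_iteratedFDeriv_le_of_hasTypeIDecay`;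
first internal step: make the constants `K(n,C)`, `n ≤ 3`, POLYNOMIAL in `C` by scaled local regularity on
cylinders of radius `ρ/C`) in place of the pigeonholed Cor. 12 (`R₂' ≤ 2R₂ exp(C(100)M^1020)`, the only
super-polynomial source): every Carleman cost becomes `exp(poly C)`, the epoch spacing `poly(C)`, the
floor `exp(−C^κ)`.  Why it might fail: a polynomial derivative envelope is needed up to the order used by
the Carleman inequalities (a merely `exp(poly C)` one still suffices; an `exp(exp)` one would not), and the
quantitative transfer of regularity INTO `{|x| ≤ poly(C)√T₂}` (BP21 Step 4) must not re-introduce a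
pigeonhole.  R0 (known): the double-exponential floor, Barker–Prange 2021 Cor. 1
(`barkerPrange2021_dss_log_rate`), unpacked per solution in `ballFloor_pos_of_BP21` below; the envelope
class sits inside its weak-`L³` class with `M = (4π/3)^{1/3}C` (`eWeakLpPow_three_le_of_hasTypeIDecay`).
Sources: arXiv:2003.06717 Cor 1, Prop 2, Cor 12; arXiv:2101.08586 Prop 8; arXiv:2510.20757 Prop 11;
arXiv:1610.09464 Thm 1.1.  TYPED STRENGTH: `∃ κ` is UNIFORM over `C ≥ 2` (levels nested,
`BallFloorSingleExp.mono`), and the statement is NOT implied by the double-exponential fact — no single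
`κ` has `exp(−C^κ) ≤ (δ/2)exp(−exp((κ_w C)^1025))` for all `C ≥ 2` — nor by Albritton–Barker 2019
Thm 4.1 (`ε(M)` non-explicit, by compactness): the rung as typed is the single-exponential claim itself.
PREDICTED LEVEL (idea-crit-4 N1; declared for falsifiability, the registered form stays `∃ κ`): re-running
Barker–Prange with the free annulus `R₂' ≍ C√T₂/ε₀` (the envelope makes the ε-regularity quantity `|v|·√T₂`
small beyond it) turns the Carleman weights `exp(O(M^2000)(R₂')²/T₂)` (arXiv:2003.06717 p. 16, `M ≍ C` on the
envelope class) into `exp(O(C^2002))`, and E2a contributes only `exp(O(log C))`; so the scheme as printed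
predicts `κ₀ ≈ 2·10³` (nominally `κ₀ = 2003`), every improvement of BP21's polynomial exponents lowering `κ₀`
but not the single-exponential SHAPE.  An instrument refuting level `κ₀` (a numerical λ-DSS profile with
`Q₁/log λ < exp(−C^{κ₀})`, certified) refutes the scheme-as-printed, not `∃ κ`. -/
theorem stub_ballFloorSingleExp_of_polyEnvelope : PolyDerivEnvelope → ∃ κ : ℕ, BallFloorSingleExp κ := by
  sorry

/-- **E3a′ (SUPPORT-grade; unconditional; the analytic statement of the transfer, no self-similarity).**
See `SliceShellBudget`: for any enveloped thin object with `q > 0`, `∫_{B(R)}‖v(−1)‖³ ≤ b + 2q(1 + log R)`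
for all `R ≥ 1`.  Why true: slice/trace comparison on `{|y|>1}` (time-derivative envelope
`|∂_t v| ≲ C·K·log(2+|y|)/(|y|+√(−t))³` from `Δv`, `v·∇v` and the Oseen pressure gradient, whose cube is
integrable off the unit ball) + Minkowski/Young + the thin budget `∫_{1<|y|<R}‖g‖³ ≤ q(1 + log R)`.
Leans on: the Oseen-mild formula inside `IsTypeIAncientMild`,
`IsTypeIAncientMild.exists_forall_pow_mul_norm_iteratedFDeriv_le_of_hasTypeIDecay`, `ThinObject`'s
weak-trace and budget clauses.  Why it might fail (Lean cost, not truth): the pointwise time-derivative /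
pressure-gradient envelope for Oseen-mild solutions and the identification of the weak trace with the
pointwise limit off the origin are not yet tree lemmas.  The DSS rescaling (`SliceShellBudget → SliceBudget`,
`sliceBudget_of_shell`) and the real-variable half (`SliceBudget → SliceToTrace`,
`sliceToTrace_of_sliceBudget`) are PROVED below. -/
theorem stub_sliceShellBudget : SliceShellBudget := by
  sorry

/-- **W (the RESIDUAL WALL; honest width 0).**  At every level `κ` at which the envelope trace floor
holds, no thin object with positive budget survives outside its kill zone.  This is S3
`stub_thinCascadeLiouville` of line `thin_cascade` minus the sliver closed by E — it still contains every
non-self-similar thin object and every DSS one with `q ≥ exp(−C^κ)`; the hypothesis only fixes the level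
and is not expected to help.  Proved strata (tree, BY NAME): `M < 1` (`not_thinObject_of_lt_one`),
near-one DSS (`thinObject_not_dss_nearOne`), self-similar (`thinObject_not_selfSimilar`).  Beyond the
Carleman family's single-exponential ceiling (arXiv:2211.16215 p. 12).  Sources: Bradshaw–Tsai 2017 §5;
Chae–Wolf 2017; Albritton–Barker 2019 Thm 4.1. -/
theorem stub_residualWall : ∀ κ : ℕ, ThinEnvelopeFloor κ → ResidualWall κ := by
  sorry

/-! ### Composition: the crux BY NAME -/

/-- E and W together exclude every thin object with positive budget (case split on the kill zone).
[this file] -/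
theorem noThinObject_of_floor_residual (hE : ∃ κ : ℕ, ThinEnvelopeFloor κ)
    (hW : ∀ κ : ℕ, ThinEnvelopeFloor κ → ResidualWall κ) :
    ∀ (M q : ℝ), 0 < q → ∀ (v : ℝ → EuclideanSpace ℝ (Fin 3) → EuclideanSpace ℝ (Fin 3)) (g : EuclideanSpace ℝ (Fin 3) → EuclideanSpace ℝ (Fin 3)), ¬ ThinObject M q v g := by
  obtain ⟨κ, hκ⟩ := hE
  intro M q hq v g hthin
  by_cases hk : KilledByFloor κ q v
  · exact hκ M q v g hq hthin hk
  · exact hW κ hκ M q v g hq hk hthin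

/-- A thin object is not the zero field: it is singular at the origin. [this file] -/
theorem ThinObject.exists_ne_zero {M q : ℝ} {v : ℝ → EuclideanSpace ℝ (Fin 3) → EuclideanSpace ℝ (Fin 3)}
    {g : EuclideanSpace ℝ (Fin 3) → EuclideanSpace ℝ (Fin 3)} (h : ThinObject M q v g) :
    ∃ t : ℝ, t < 0 ∧ ∃ x, v t x ≠ 0 := by
  obtain ⟨t, ht, y, -, hy⟩ := h.2.2.1 1 one_pos 0
  exact ⟨t, ht.2, y, fun h0 => by simp [h0] at hy⟩

/-- A thin object with an envelope of constant `C ≥ 0` is a Type-I ancient mild solution with time-decay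
constant `C` (the class is the same; only the recorded constant changes). [this file] -/
theorem ThinObject.isTypeIAncientMild_of_hasTypeIDecay {M q C : ℝ}
    {v : ℝ → EuclideanSpace ℝ (Fin 3) → EuclideanSpace ℝ (Fin 3)} {g : EuclideanSpace ℝ (Fin 3) → EuclideanSpace ℝ (Fin 3)}
    (h : ThinObject M q v g) (hC : 0 ≤ C) (hdec : HasTypeIDecay C v) : IsTypeIAncientMild C v :=
  ⟨h.1.1, h.1.2.1, h.1.2.2.1, hdec.hasTypeITimeDecay hC⟩

/-- **E derived (v1's stub E is now a theorem of E2 and E3).**  The ball-form single-exponential floor and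
the slice-to-trace transfer give the envelope TRACE floor: every `c`-DSS thin object with envelope constant
`C ≥ 2` has `q ≥ exp(−C^κ)`, with the SAME `κ`. [this file] -/
theorem envelopeTraceFloor_of (h2 : ∃ κ : ℕ, BallFloorSingleExp κ) (h3 : SliceToTrace) :
    ∃ κ : ℕ, ThinEnvelopeFloor κ := by
  obtain ⟨κ, hκ⟩ := h2
  refine ⟨κ, fun M q v g hq0 hthin hk => ?_⟩
  obtain ⟨C, c, hc, hdss, hdec, hC2, hq⟩ := hk
  have hC0 : (0 : ℝ) ≤ C := by linarith
  have hmild : IsTypeIAncientMild C v := ThinObject.isTypeIAncientMild_of_hasTypeIDecay hthin hC0 hdec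
  have hfloor := hκ C c v hC2 hc hdss hmild hdec (ThinObject.exists_ne_zero hthin)
  have hle : Real.exp (-(C ^ κ)) ≤ q :=
    h3 M q C c (Real.exp (-(C ^ κ))) v g hthin hq0 hC0 hdec hc hdss (Real.exp_pos _) hfloor
  exact absurd hq (not_lt.2 hle)

/-- **DSS rescaling of the unit-ball cube (PROVED).**  For a `c`-DSS field, the unit-ball cube at the
DSS time `t_k = −c^{−2k}` equals the cube over `B(c^k)` at time `−1`:
`∫_{B(1)}‖v(t_k)‖³ = ∫_{B(c^k)}‖v(−1)‖³` (pointwise `v(t_k, x) = c^k v(−1, c^k x)` and the change of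
variables `x ↦ c^k x`, under which the `L³` cube is scale-invariant). [this file] -/
theorem lintegral_ball_dss_time {c : ℝ} (hc : 1 < c)
    {v : ℝ → EuclideanSpace ℝ (Fin 3) → EuclideanSpace ℝ (Fin 3)} (hdss : IsDiscretelySelfSimilar c v) (k : ℕ) :
    ∫⁻ x in Metric.ball (0 : EuclideanSpace ℝ (Fin 3)) 1, ‖v (-(c ^ (2 * k))⁻¹) x‖ₑ ^ (3 : ℕ) =
      ∫⁻ x in Metric.ball (0 : EuclideanSpace ℝ (Fin 3)) (c ^ k), ‖v (-1) x‖ₑ ^ (3 : ℕ) := by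
  set L : ℝ := c ^ k with hLdef
  have hL : 0 < L := pow_pos (by linarith) k
  have hk : IsDiscretelySelfSimilar L v := ChaeWolf.isDiscretelySelfSimilar_pow hdss k
  have hpt : ∀ x : EuclideanSpace ℝ (Fin 3), v (-(c ^ (2 * k))⁻¹) x = L • v (-1) (L • x) := by
    intro x
    have h := ChaeWolf.dss_apply_eq hk (-(c ^ (2 * k))⁻¹) x
    rw [← h]
    congr 1
    have hL2 : L ^ 2 = c ^ (2 * k) := by rw [hLdef, ← pow_mul, mul_comm]
    rw [hL2]
    field_simp
  have hcongr : ∫⁻ x in Metric.ball (0 : EuclideanSpace ℝ (Fin 3)) 1, ‖v (-(c ^ (2 * k))⁻¹) x‖ₑ ^ (3 : ℕ) =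
      ∫⁻ x in Metric.ball (0 : EuclideanSpace ℝ (Fin 3)) 1,
        ENNReal.ofReal (L ^ 3) * ‖v (-1) (L • x)‖ₑ ^ (3 : ℕ) := by
    refine lintegral_congr (fun x => ?_)
    rw [hpt x, enorm_smul, mul_pow, Real.enorm_of_nonneg hL.le, ENNReal.ofReal_pow hL.le]
  have hcv := Tsai2021.lintegral_comp_smul_set
    (fun y => ENNReal.ofReal (L ^ 3) * ‖v (-1) y‖ₑ ^ (3 : ℕ)) hL
    (measurableSet_ball : MeasurableSet (Metric.ball (0 : EuclideanSpace ℝ (Fin 3)) 1))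
  rw [hcongr, hcv, smul_unitBall_of_pos hL,
    lintegral_const_mul' _ _ ENNReal.ofReal_ne_top, ← mul_assoc, ← ENNReal.ofReal_mul (by positivity),
    inv_mul_cancel₀ (by positivity), ENNReal.ofReal_one, one_mul]

/-- **E3a from E3a′ by DSS rescaling (PROVED).**  The shell budget of the slice at `t = −1` turns into
the growth bound of the unit-ball cubes along the DSS times. [this file] -/
theorem sliceBudget_of_shell (h : SliceShellBudget) : SliceBudget := by
  intro M q C c v g hthin hq hC hdec hc hdss
  obtain ⟨b, hb⟩ := h M q C v g hthin hq hC hdec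
  refine ⟨b, fun k => ?_⟩
  rw [lintegral_ball_dss_time hc hdss k]
  have h1 : (1 : ℝ) ≤ c ^ k := one_le_pow₀ hc.le
  have := hb (c ^ k) h1
  rwa [Real.log_pow] at this

/-- **E3b PROVED: the real-variable half of the transfer.**  If the unit-ball cubes at the DSS times
grow at most like `b + 2q(1 + k log c)` (`SliceBudget`), then a ball-form floor `θ·log(1/(−t))` on a
window `[t₀,0)` forces `θ ≤ q`: at `t_k = −c^{−2k}` the floor reads `2kθ log c`, and
`2kθ log c ≤ b + 2q + 2qk log c` for all large `k` is impossible when `q < θ`. [this file] -/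
theorem sliceToTrace_of_sliceBudget (hB : SliceBudget) : SliceToTrace := by
  intro M q C c θ v g hthin hq hC hdec hc hdss hθ hfloor
  obtain ⟨t₀, ht₀, hfl⟩ := hfloor
  obtain ⟨b, hb⟩ := hB M q C c v g hthin hq hC hdec hc hdss
  by_contra hlt
  push Not at hlt
  have hL : 0 < Real.log c := Real.log_pos hc
  have hD : 0 < 2 * Real.log c * (θ - q) := by
    have : 0 < θ - q := by linarith
    positivity
  obtain ⟨k₁, hk₁⟩ := exists_nat_gt ((b + 2 * q) / (2 * Real.log c * (θ - q)))
  obtain ⟨k₂, hk₂⟩ := pow_unbounded_of_one_lt (1 / (-t₀)) hc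
  set k : ℕ := max (max k₁ k₂) 1 with hkdef
  have hk₁k : k₁ ≤ k := (le_max_left _ _).trans (le_max_left _ _)
  have hk₂k : k₂ ≤ k := (le_max_right _ _).trans (le_max_left _ _)
  have hk1 : 1 ≤ k := le_max_right _ _
  have hc0 : 0 < c := by linarith
  have hpow : 0 < c ^ (2 * k) := pow_pos hc0 _
  -- the DSS time `t_k = -(c^(2k))⁻¹` lies in the window
  have ht0 : 0 < -t₀ := neg_pos.2 ht₀
  have h1 : 1 / (-t₀) < c ^ (2 * k) :=
    hk₂.trans_le (pow_le_pow_right₀ hc.le (by omega))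
  have h2 : (c ^ (2 * k))⁻¹ < -t₀ := by
    rw [one_div] at h1
    exact inv_lt_of_inv_lt₀ ht0 h1
  have hmem : -(c ^ (2 * k))⁻¹ ∈ Set.Ico t₀ 0 :=
    ⟨by linarith, neg_neg_of_pos (inv_pos.2 hpow)⟩
  have hcomb := (hfl _ hmem).trans (hb k)
  -- the floor at `t_k` reads `θ · (2k log c)`
  have hlog : Real.log (1 / (-(-(c ^ (2 * k))⁻¹))) = 2 * (k : ℝ) * Real.log c := by
    rw [neg_neg, one_div, inv_inv, Real.log_pow]
    push_cast
    ring
  rw [hlog] at hcomb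
  have hk₁' : b + 2 * q < 2 * Real.log c * (θ - q) * k := by
    have hlt' : (b + 2 * q) / (2 * Real.log c * (θ - q)) < (k : ℝ) :=
      hk₁.trans_le (by exact_mod_cast hk₁k)
    rw [div_lt_iff₀ hD] at hlt'
    linarith
  have hkpos : (1 : ℝ) ≤ k := by exact_mod_cast hk1
  have hLHS : 0 < θ * (2 * (k : ℝ) * Real.log c) := by positivity
  by_cases hR : 0 ≤ b + 2 * q * (1 + k * Real.log c)
  · have hreal := (ENNReal.ofReal_le_ofReal_iff hR).1 hcomb
    nlinarith
  · push Not at hR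
    rw [ENNReal.ofReal_of_nonpos hR.le] at hcomb
    have h0 : ENNReal.ofReal (θ * (2 * (k : ℝ) * Real.log c)) = 0 := le_antisymm hcomb bot_le
    rw [ENNReal.ofReal_eq_zero] at h0
    linarith

/-- **The crux from the stubs, BY NAME.**  `TypeIQuantSubcubicExp` follows from E2, E3 and W through the
derived trace floor and the tree's per-`M` transfer `quantSubcubicExpAt_of_noThinObject` (line
`thin_cascade`, S1 + I1 + S2 landed).  No summit statement is proved: E2 and W are open (W is the DSS
wall); E3 is an unconditional transfer lemma. [this file] -/
theorem TypeIQuantSubcubicExp_of :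
    PolyDerivEnvelope → (PolyDerivEnvelope → ∃ κ : ℕ, BallFloorSingleExp κ) → SliceShellBudget →
    (∀ κ : ℕ, ThinEnvelopeFloor κ → ResidualWall κ) →
    Summit.NavierStokesRegularity.NavierStokesRegularity.Theses.QuarterLogPincer.TypeIQuantSubcubicExp :=
  fun h2a h2b h3 hW M => quantSubcubicExpAt_of_noThinObject M
    (fun q hq v g => noThinObject_of_floor_residual
      (envelopeTraceFloor_of (h2b h2a) (sliceToTrace_of_sliceBudget (sliceBudget_of_shell h3))) hW M q hq v g)

/-- The same, literally from the registered stubs. [this file] -/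
theorem TypeIQuantSubcubicExp_holds_of_stubs :
    Summit.NavierStokesRegularity.NavierStokesRegularity.Theses.QuarterLogPincer.TypeIQuantSubcubicExp :=
  TypeIQuantSubcubicExp_of stub_polyDerivEnvelope stub_ballFloorSingleExp_of_polyEnvelope stub_sliceShellBudget
    stub_residualWall

/-! ### Proved: the envelope class sits inside Barker–Prange's Type-I class, with `M = (4π/3)^{1/3} C` -/

/-- **Envelope ⇒ weak-`L³` Type I, quantitatively.**  If `‖v(t,x)‖ ≤ C/(‖x‖ + √(−t))` for all `t < 0`
(`HasTypeIDecay C v`, `C ≥ 0`), then for every `t < 0` the weak-`L³` quasinorm cube of the slice obeys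
`sup_τ τ³ |{‖v(t)‖ > τ}| ≤ C³ |B₁|`: the superlevel set `{‖v(t)‖ > τ}` lies in the ball `B(0, C/τ)`.
This is hypothesis `‖u‖_{L^∞_t L^{3,∞}_x} ≤ M` of Barker–Prange 2021 Thm 1 with `(M)³ = C³|B₁|`,
i.e. `M = (4π/3)^{1/3} C` (cf. arXiv:2003.06717 p. 11, "(DSSboundchaewolf) implies …"). [folklore] -/
theorem eWeakLpPow_three_le_of_hasTypeIDecay {C : ℝ} (hC : 0 ≤ C) {v : ℝ → EuclideanSpace ℝ (Fin 3) → EuclideanSpace ℝ (Fin 3)}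
    (hdec : HasTypeIDecay C v) {t : ℝ} (ht : t < 0) :
    FunctionSpaces.eWeakLpPow (v t) 3 volume ≤
      ENNReal.ofReal (C ^ 3) * volume (ball (0 : EuclideanSpace ℝ (Fin 3)) 1) := by
  refine FunctionSpaces.eWeakLpPow_le_iff.2 fun τ => ?_
  have h3 : ((3 : ℝ≥0∞)).toReal = ((3 : ℕ) : ℝ) := by norm_num
  rw [h3, ENNReal.rpow_natCast]
  rcases eq_or_ne τ 0 with rfl | hτ0
  · simp
  have hτ : 0 < (τ : ℝ) := NNReal.coe_pos.2 (pos_iff_ne_zero.2 hτ0)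
  have hst : 0 < Real.sqrt (-t) := Real.sqrt_pos.2 (neg_pos.2 ht)
  -- the superlevel set sits in `B(0, C/τ)`
  have hsub : {x : EuclideanSpace ℝ (Fin 3) | (τ : ℝ≥0∞) < ‖v t x‖ₑ} ⊆ ball (0 : EuclideanSpace ℝ (Fin 3)) (C / τ) := by
    intro x hx
    rw [mem_setOf_eq, ← ofReal_norm, ← ENNReal.ofReal_coe_nnreal,
      ENNReal.ofReal_lt_ofReal_iff_of_nonneg (NNReal.coe_nonneg τ)] at hx
    rw [mem_ball_zero_iff]
    by_contra hle
    push Not at hle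
    have hxpos : 0 < ‖x‖ + Real.sqrt (-t) := by positivity
    have h1 : ‖v t x‖ ≤ C / (‖x‖ + Real.sqrt (-t)) := hdec t ht x
    have h2 : C ≤ (τ : ℝ) * ‖x‖ := by
      have := (div_le_iff₀ hτ).1 hle
      linarith [mul_comm (τ : ℝ) ‖x‖]
    have h3' : C / (‖x‖ + Real.sqrt (-t)) < (τ : ℝ) := by
      rw [div_lt_iff₀ hxpos]
      nlinarith [NNReal.coe_nonneg τ]
    linarith
  calc (τ : ℝ≥0∞) ^ (3 : ℕ) * volume {x : EuclideanSpace ℝ (Fin 3) | (τ : ℝ≥0∞) < ‖v t x‖ₑ}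
      ≤ (τ : ℝ≥0∞) ^ (3 : ℕ) * volume (ball (0 : EuclideanSpace ℝ (Fin 3)) (C / τ)) := by
        gcongr
    _ = ENNReal.ofReal (C ^ 3) * volume (ball (0 : EuclideanSpace ℝ (Fin 3)) 1) := by
        rw [Measure.addHaar_ball volume (0 : EuclideanSpace ℝ (Fin 3)) (div_nonneg hC hτ.le), finrank_euclideanSpace_fin,
          ← mul_assoc, ← ENNReal.ofReal_coe_nnreal, ← ENNReal.ofReal_pow (NNReal.coe_nonneg τ),
          ← ENNReal.ofReal_mul (pow_nonneg (NNReal.coe_nonneg τ) _), ← mul_pow,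
          mul_div_cancel₀ _ hτ.ne']

/-- **Envelope ⇒ Barker–Prange's Type-I hypothesis in its literal shape** (`eWeakLpPow ≤ ofReal(M)^3`
with `M = (|B₁| C³)^{1/3}`-free form: we record it with the explicit constant `M₁ := C · K` for any
`K ≥ 0` with `|B₁| ≤ K³`, e.g. `K = 2` since `4π/3 < 8`). [folklore] -/
theorem eWeakLpPow_three_le_cube_of_hasTypeIDecay {C K : ℝ} (hC : 0 ≤ C) (hK : 0 ≤ K)
    (hB : volume (ball (0 : EuclideanSpace ℝ (Fin 3)) 1) ≤ ENNReal.ofReal (K ^ 3)) {v : ℝ → EuclideanSpace ℝ (Fin 3) → EuclideanSpace ℝ (Fin 3)}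
    (hdec : HasTypeIDecay C v) {t : ℝ} (ht : t < 0) :
    FunctionSpaces.eWeakLpPow (v t) 3 volume ≤ ENNReal.ofReal (C * K) ^ (3 : ℕ) := by
  refine (eWeakLpPow_three_le_of_hasTypeIDecay hC hdec ht).trans ?_
  calc ENNReal.ofReal (C ^ 3) * volume (ball (0 : EuclideanSpace ℝ (Fin 3)) 1)
      ≤ ENNReal.ofReal (C ^ 3) * ENNReal.ofReal (K ^ 3) := by gcongr
    _ = ENNReal.ofReal (C * K) ^ (3 : ℕ) := by
        rw [← ENNReal.ofReal_mul (pow_nonneg hC 3), ← mul_pow,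
          ENNReal.ofReal_pow (mul_nonneg hC hK)]

/-! ### Proved: R0 of the rung, per solution, from the Barker–Prange named fact -/

/-- **R0 (known near-miss, unpacked BY NAME).**  Under Barker–Prange 2021 Cor. 1
(`barkerPrange2021_dss_log_rate`, used as a hypothesis — a cited, unproved Literature fact), every
non-zero backward `λ`-DSS classical solution of the Chae–Wolf class (unit viscosity) has a POSITIVE
asymptotic floor on its local cube: `θ · log(1/(−t)) ≤ ∫_{B(1)} |u(t)|³` on a window `[t₀, 0)`, with
`θ = exp(−exp(M^1025))/4` for the solution's Barker–Prange constant `M` (take `δ = 1/2`).  This is the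
`∃ θ > 0` (per-solution, double-exponential) rung below stub E's class-uniform single exponential.
[cite: BarkerPrange2021, Cor. 1 (arXiv:2003.06717 pp. 3–4)] -/
theorem ballFloor_pos_of_BP21 (hBP : barkerPrange2021_dss_log_rate)
    (u : ℝ → EuclideanSpace ℝ (Fin 3) → EuclideanSpace ℝ (Fin 3)) (p : ℝ → EuclideanSpace ℝ (Fin 3) → ℝ) {lam : ℝ} (hlam : 1 < lam)
    (hdss : IsDiscretelySelfSimilar lam u) (hsol : IsClassicalNSSolutionOn (Iio 0) 1 0 u p)
    (hLq : ∃ q : ℝ≥0∞, 3 ≤ q ∧ q < ∞ ∧ ContinuousInLpOn (Iio 0) q u)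
    (hne : ∃ t, t < 0 ∧ ∃ x, u t x ≠ 0) :
    ∃ θ : ℝ, 0 < θ ∧ ∃ t₀ : ℝ, t₀ < 0 ∧ ∀ t ∈ Ico t₀ 0,
      ENNReal.ofReal (θ * Real.log (1 / (-t))) ≤
        ∫⁻ x in ball (0 : EuclideanSpace ℝ (Fin 3)) 1, ‖u t x‖ₑ ^ (3 : ℕ) := by
  obtain ⟨M, hM, hδ⟩ := hBP 1 one_pos u p lam hlam hdss hsol hLq hne
  obtain ⟨Cw, hCw, hwin⟩ := hδ (1 / 2) (by norm_num) (by norm_num)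
  refine ⟨Real.exp (-Real.exp (M ^ (1025 : ℕ))) / 4, by positivity,
    max (-(1 / (2 * (1 : ℝ)))) (-Cw), ?_, fun t ht => ?_⟩
  · exact max_lt (by norm_num) (neg_neg_iff_pos.2 hCw |>.trans_le le_rfl |> fun h => by linarith)
  · have hwin' := (hwin t ht).1
    have ht0 : t < 0 := ht.2
    -- rewrite the Barker–Prange left-hand side at `ν = 1`, `δ = 1/2`
    have hlog : Real.log (1 / (-(1 * t)) ^ ((1 / 2 : ℝ) / 2)) = (1 / 4) * Real.log (1 / (-t)) := by
      have hpos : 0 < -t := neg_pos.2 ht0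
      simp only [one_mul, one_div, Real.log_inv, Real.log_rpow hpos]
      ring
    have hlhs : (1 : ℝ) ^ 3 * Real.log (1 / (-(1 * t)) ^ ((1 / 2 : ℝ) / 2)) /
        Real.exp (Real.exp (M ^ (1025 : ℕ))) =
        Real.exp (-Real.exp (M ^ (1025 : ℕ))) / 4 * Real.log (1 / (-t)) := by
      rw [hlog, one_pow, one_mul, Real.exp_neg]
      field_simp
    rw [← hlhs]
    exact hwin'

/-! ### Proved: bookkeeping on the kill zone -/

/-- The kill zones are nested: a higher level kills less (`exp(−C^κ')≤ exp(−C^κ)` for `κ ≤ κ'`,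
`C ≥ 2`), so a floor of level `κ` implies the floor of every level `κ' ≥ κ`. [this file] -/
theorem ThinEnvelopeFloor.mono {κ κ' : ℕ} (hκ : κ ≤ κ') (h : ThinEnvelopeFloor κ) :
    ThinEnvelopeFloor κ' := by
  intro M q v g hq0 hthin hk
  obtain ⟨C, c, hc, hdss, hdec, hC, hq⟩ := hk
  refine h M q v g hq0 hthin ⟨C, c, hc, hdss, hdec, hC, hq.trans_le ?_⟩
  apply Real.exp_le_exp.2
  have h1 : (1 : ℝ) ≤ C := by linarith
  have := pow_le_pow_right₀ h1 hκ
  linarith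

/-- The ball-form levels are nested in the same way. [this file] -/
theorem BallFloorSingleExp.mono {κ κ' : ℕ} (hκ : κ ≤ κ') (h : BallFloorSingleExp κ) :
    BallFloorSingleExp κ' := by
  intro C c v hC hc hdss hmild hdec hne
  obtain ⟨t₀, ht₀, hfl⟩ := h C c v hC hc hdss hmild hdec hne
  refine ⟨max t₀ (-1), max_lt ht₀ (by norm_num), fun t ht =>
    le_trans ?_ (hfl t ⟨(le_max_left _ _).trans ht.1, ht.2⟩)⟩
  apply ENNReal.ofReal_le_ofReal
  have h0 : 0 < -t := neg_pos.2 ht.2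
  have hlog : 0 ≤ Real.log (1 / (-t)) := by
    apply Real.log_nonneg
    rw [le_div_iff₀ h0, one_mul]
    have : -1 ≤ t := (le_max_right _ _).trans ht.1
    linarith
  apply mul_le_mul_of_nonneg_right _ hlog
  apply Real.exp_le_exp.2
  have h1 : (1 : ℝ) ≤ C := by linarith
  have := pow_le_pow_right₀ h1 hκ
  linarith

/-- A thin object in NO kill zone of any level with a DSS-envelope structure of constant `C ≥ 2` has
`q ≥ 0`-budget at least every `exp(−C^κ)`; conversely the floor of level `κ` says exactly that DSS
enveloped thin objects have `exp(−C^κ) ≤ q`. [this file] -/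
theorem le_budget_of_floor {κ : ℕ} (h : ThinEnvelopeFloor κ) {M q C c : ℝ} {v : ℝ → EuclideanSpace ℝ (Fin 3) → EuclideanSpace ℝ (Fin 3)}
    {g : EuclideanSpace ℝ (Fin 3) → EuclideanSpace ℝ (Fin 3)} (hthin : ThinObject M q v g) (hq : 0 < q) (hc : 1 < c)
    (hdss : IsDiscretelySelfSimilar c v)
    (hdec : HasTypeIDecay C v) (hC : 2 ≤ C) : Real.exp (-(C ^ κ)) ≤ q := by
  by_contra hlt
  push Not at hlt
  exact h M q v g hq hthin ⟨C, c, hc, hdss, hdec, hC, hlt⟩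

end Summit.NavierStokesRegularity.NavierStokesRegularity.Cruxes.TypeIQuantSubcubicExp.TraceFloor
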